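import Summits.ABC.IUTFork.DAGC312m
import Literature.IUT.LogThetaLattice.RadialData
import Literature.IUT.HodgeArakelov.GaloisPairRigidityReadings
import Literature.IUT.HodgeArakelov.RadialGraphs

/-!
# Kernel DAG index — layer C312, part n: knitting DELTA 5 (completing the partly-knitted loci) and the reading `lociReadingH`

index v1 · abc-iut-c312-2 (filer, gen 2) per HOME/plan/KERNEL-DAG-SPEC.md v1.3 §2(a)–(c),(e). APPEND-ONLY: seven more node blocks for
landed Cor-3.12 pins (kernel_ids from plan/DAG.tsv), and ONE new outermost reading `lociReadingH S pending` which DECIDES the loci it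
completes and otherwise falls through to `lociReadingG S pending` (part l) — so nothing filed earlier is redefined, and H ∘ G ∘ F ∘ M ∘ V2
∘ Δ3 ∘ Δ4 is the composed reading of record after this part.

What H completes (each was `… ∧ pending c` before):
* [IUTchIII] Cor 2.3 ↦ `N_…Cor2_3_i ∧ N_…Cor2_3_ii ∧ N_…Cor2_3_iii ∧ N_…Cor2_3_iv` — (i) `radialAlgorithm_full/_essSurj`,
  `thetaRadialEnvironment_isMultiradial` (L6-t3 `RadialData` p406648), (iii),(iv) `ThetaMonoidData.cor23iii_full/cor23iv_equivariant`
  (`ThetaMonoids` p405523) — all with `_part` witnesses (rows landed, not yet ticked discharged);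
* Rmk 1.5.1 ↦ `N_…Rmk1_5_1_i ∧ N_…Rmk1_5_1_ii` — (i) the quoted group identity `conj_diag_eq_commutator_mul` (L6-t3 `LogWallRemarks`, PROVED);
* Rmk 2.3.3 ↦ `N_…_vi ∧ N_…_vii` — (viii) is discharged(p404240) with NO decl (docstring-covered in L6-t3 `RemarksArithmetic`): noted, nothing
  to grant;
* [IUTchII] Rmk 1.11.3 ↦ `(ii) ∧ (i) ∧ (iii) ∧ (v)` — L6-t1's READINGS `Rmk1113_i/iii/v_reading` (`GaloisPairRigidityReadings` p410540, PROVED);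
  (iv) is the cross-reference to [IUTchII] Ex 1.9 (iii) (`ex19iii`, data alias);
* the four SECTION-LEVEL citations ([IUTchI] §2 at Step (viii); [IUTchI] §§4–6 at (vii); [IUTchII] §2 at (viii); [IUTchII] §3 "especially
  Cors 3.5, 3.6" at (vi)) ↦ `True`: a pointer to a theory, no single statement to grant; their items are indexed as DATA/claim nodes in
  DAGL5a–c / DAGL6a–d (e.g. `N_IUTchII_Cor3_5_i`, `N_IUTchII_Cor3_6_i`, `N_IUTchI_Def6_1_iii`).
Census (`knitted_count_v5`): 82 of 85 loci resolved for a full situation; `unresolvedV5` = [(SHE), [AbsAnab] Prop 1.2.1 (vii) (typed only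
as a mention by L4-t4), [EtTh] (whole-paper citation: seven landed nodes ∧ pending)] — `lociReadingH_of_three`: Theorem 3.11 as typed + (IPL)
+ `pending` at these THREE loci grant all 85; apex `summit_of_cor312_M_three` (kernel_hyps = 11 as in part m, `hrest` over 3 loci);
`steps_consulting_pending`: only Steps (ii), (vi), (xi-b)–(xi-e), (xi-h) cite an unresolved locus; `derivable_xi_f_iff_three`: in the
least reading (`Cor312Least`) the (xi-f) observation is derivable, given Thm 3.11 + (IPL), iff exactly these three loci are granted.
THIS FILE PROVES NOTHING NEW AND ASSERTS NOTHING; no side taken on [IUTchIII] Cor. 3.12. typed ≠ discharged; indexed ≠ endorsed.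
[claim: Mochizuki2012, status: disputed]
-/

noncomputable section

namespace Summit.ABC.IUTFork.DAG

open Cor312Proof Thm311 PartC312k

universe u₁ u₂ u₃ u₄

/-! ## 1. Node blocks -/

/-- [node IUTchIII:Cor2.3(i) · L6/D3 · [IUTchIII] Cor 2.3 (i), kurims p.74 l.4 · p406648 `RadialData` · claim · DAG status landed(p406648)] the
functor of the radial algorithm is full and essentially surjective; the radial environment is multiradial. Cited at Step (ii). -/
def N_IUTchIII_Cor2_3_i : Prop :=
  StatementOf @Literature.IUT.LogThetaLattice.radialAlgorithm_full.{u₁} ∧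
  StatementOf @Literature.IUT.LogThetaLattice.radialAlgorithm_essSurj.{u₁} ∧
  StatementOf @Literature.IUT.LogThetaLattice.thetaRadialEnvironment_isMultiradial.{u₁}
/-- partial witness (row landed, not ticked discharged) of `N_IUTchIII_Cor2_3_i`: BY NAME; proves nothing new. -/
theorem N_IUTchIII_Cor2_3_i_part : N_IUTchIII_Cor2_3_i :=
  ⟨@Literature.IUT.LogThetaLattice.radialAlgorithm_full, @Literature.IUT.LogThetaLattice.radialAlgorithm_essSurj,
   @Literature.IUT.LogThetaLattice.thetaRadialEnvironment_isMultiradial⟩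
example := @Literature.IUT.LogThetaLattice.thetaRadialEnvironment

/-- [node IUTchIII:Cor2.3(iii) · L6/D3 · [IUTchIII] Cor 2.3 (iii), kurims p.75 l.2 · p405523 `ThetaMonoids` · claim · DAG status landed(p405523)]
the (e_ℜ) full poly-isomorphism transported along the Kummer isomorphisms. Cited at Step (ii). -/
abbrev N_IUTchIII_Cor2_3_iii : Prop := StatementOf @Literature.IUT.LogThetaLattice.ThetaMonoidData.cor23iii_full.{u₁}
/-- partial witness of `N_IUTchIII_Cor2_3_iii`: BY NAME; proves nothing new. -/
theorem N_IUTchIII_Cor2_3_iii_part : N_IUTchIII_Cor2_3_iii := @Literature.IUT.LogThetaLattice.ThetaMonoidData.cor23iii_full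

/-- [node IUTchIII:Cor2.3(iv) · L6/D3 · [IUTchIII] Cor 2.3 (iv), kurims p.75 l.7 · p405523 `ThetaMonoids` · claim · DAG status landed(p405523)]
stabilized/equivariant/functorial w.r.t. automorphisms. Cited at Step (ii). -/
abbrev N_IUTchIII_Cor2_3_iv : Prop := StatementOf @Literature.IUT.LogThetaLattice.ThetaMonoidData.cor23iv_equivariant.{u₁}
/-- partial witness of `N_IUTchIII_Cor2_3_iv`: BY NAME; proves nothing new. -/
theorem N_IUTchIII_Cor2_3_iv_part : N_IUTchIII_Cor2_3_iv := @Literature.IUT.LogThetaLattice.ThetaMonoidData.cor23iv_equivariant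

/-- [node IUTchIII:Rmk1.5.1(i) · L6/D3 · [IUTchIII] Rmk 1.5.1 (i), kurims p.51 l.23 · p404659 `LogWallRemarks` · claim · DAG status
discharged(p404659)] the group identity quoted for the conjugate synchronization `(g, hgh⁻¹) = (g, [h,g]·g)` (the remark's prose is noted
in the module docstring). Cited at Step (vii). -/
abbrev N_IUTchIII_Rmk1_5_1_i : Prop := StatementOf @Literature.IUT.LogThetaLattice.conj_diag_eq_commutator_mul.{u₁}
/-- discharge of `N_IUTchIII_Rmk1_5_1_i`: BY NAME; proves nothing new. -/
theorem N_IUTchIII_Rmk1_5_1_i_holds : N_IUTchIII_Rmk1_5_1_i := @Literature.IUT.LogThetaLattice.conj_diag_eq_commutator_mul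

/-- [node IUTchII:Rmk1.11.3(i) · L6/D2 · [IUTchII] Rmk 1.11.3 (i), kurims pp.51–52 · p410540 `GaloisPairRigidityReadings` · claim (READING,
PROVED) · DAG status noted→reading] adjoining group-theoretic constructions to the coric data keeps a radial environment radial. Step (vi). -/
abbrev N_IUTchII_Rmk1_11_3_i : Prop := StatementOf @Literature.IUT.HodgeArakelov.Rmk1113_i_reading.{u₁, u₂, u₃, u₄}
/-- witness of `N_IUTchII_Rmk1_11_3_i` (the reading is a landed theorem): BY NAME; proves nothing new. -/
theorem N_IUTchII_Rmk1_11_3_i_holds : N_IUTchII_Rmk1_11_3_i := @Literature.IUT.HodgeArakelov.Rmk1113_i_reading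
example := @Literature.IUT.HodgeArakelov.RadialEnvironment.adjoinCoric

/-- [node IUTchII:Rmk1.11.3(iii) · L6/D2 · [IUTchII] Rmk 1.11.3 (iii), kurims pp.52–53 · p410540 · claim (READING, PROVED) · DAG status
noted→reading] the triviality of the relating homomorphism, over the [AbsTopIII] interface. Step (vi). -/
abbrev N_IUTchII_Rmk1_11_3_iii : Prop := StatementOf @Literature.IUT.HodgeArakelov.Rmk1113_iii_reading.{u₁}
/-- witness of `N_IUTchII_Rmk1_11_3_iii`: BY NAME; proves nothing new. -/
theorem N_IUTchII_Rmk1_11_3_iii_holds : N_IUTchII_Rmk1_11_3_iii := @Literature.IUT.HodgeArakelov.Rmk1113_iii_reading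

/-- [node IUTchII:Rmk1.11.3(iv) · L6/D2 · [IUTchII] Rmk 1.11.3 (iv), kurims p.53 · p409065 · cross-reference (data alias) · DAG status
landed(p409065)] eliminating the indeterminacy via the uniradial environment = [IUTchII] Ex 1.9 (iii) (`RadialGraphs.ex19iii`). Step (vi). -/
abbrev N_IUTchII_Rmk1_11_3_iv := @Literature.IUT.HodgeArakelov.ex19iii
example := @Literature.IUT.HodgeArakelov.ex19iii_uniradiallyDefined

/-- [node IUTchII:Rmk1.11.3(v) · L6/D2 · [IUTchII] Rmk 1.11.3 (v), kurims pp.53–54 · p410540 · claim (READING, PROVED) · DAG status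
noted→reading] the cyclotome comparison `Π_μ(M^Θ_*(Π))` vs `μ_Ẑ(O^×(G))` through `(l·Δ_Θ)(Π)`. Step (vi). -/
abbrev N_IUTchII_Rmk1_11_3_v : Prop := StatementOf @Literature.IUT.HodgeArakelov.Rmk1113_v_reading.{u₁}
/-- witness of `N_IUTchII_Rmk1_11_3_v`: BY NAME; proves nothing new. -/
theorem N_IUTchII_Rmk1_11_3_v_holds : N_IUTchII_Rmk1_11_3_v := @Literature.IUT.HodgeArakelov.Rmk1113_v_reading
example := @Literature.IUT.HodgeArakelov.GaloisPairRigidityData.cyclotomeComparison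

/-! ## 2. The outermost reading H -/

/-- `overrideV5 pending`: `pending` at the three loci H leaves open, `True` elsewhere — what H hands down to `lociReadingG` (the loci G would
consult `pending` at, other than these three, are all decided by H itself, so the override is invisible at every locus). [folklore] -/
def overrideV5 (pending : Locus → Prop) (c : Locus) : Prop :=
  match c with
  | .SHE => pending .SHE
  | .absAnab_prop1_2_1_vii => pending .absAnab_prop1_2_1_vii
  | .etTh => pending .etTh
  | _ => True

/-- THE COMPOSED READING OF RECORD after Δ5: decides the four completed loci and the four section-level citations, otherwise
`lociReadingG S (overrideV5 pending)`. [claim: Mochizuki2012, status: disputed] -/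
def lociReadingH {T : ThetaIndex} (S : FullSituation T) (pending : Locus → Prop) (c : Locus) : Prop :=
  match c with
  | .cor2_3 => N_IUTchIII_Cor2_3_i.{0} ∧ N_IUTchIII_Cor2_3_ii.{0} ∧ N_IUTchIII_Cor2_3_iii.{0} ∧ N_IUTchIII_Cor2_3_iv.{0}
  | .rem1_5_1 => N_IUTchIII_Rmk1_5_1_i.{0} ∧ N_IUTchIII_Rmk1_5_1_ii.{0}
  | .rem2_3_3 => N_IUTchIII_Rmk2_3_3_vi.{0} ∧ N_IUTchIII_Rmk2_3_3_vii -- (viii): discharged(p404240), docstring-covered, no decl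
  | .chII_rem1_11_3 => N_IUTchII_Rmk1_11_3_ii.{0} ∧ N_IUTchII_Rmk1_11_3_i.{0, 0, 0, 0} ∧ N_IUTchII_Rmk1_11_3_iii.{0} ∧
      N_IUTchII_Rmk1_11_3_v.{0} -- (iv): cross-reference alias `N_IUTchII_Rmk1_11_3_iv` (data)
  -- SECTION-LEVEL citations: a pointer to a theory, no single statement; items indexed in DAGL5a–c / DAGL6a–d
  | .chI_sec2 => True -- [IUTchI] §2 (Step (viii)): DAGL5a/b nodes
  | .chI_sec4_5_6 => True -- [IUTchI] §§4–6 (Step (vii)): DAGL5b/c nodes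
  | .chII_sec2 => True -- [IUTchII] §2 (Step (viii)): DAGL6a/b nodes
  | .chII_sec3_cor3_5_3_6 => True -- [IUTchII] §3, esp. Cors 3.5, 3.6 (Step (vi)): `N_IUTchII_Cor3_5_i`, `N_IUTchII_Cor3_6_i` (DAGL6d)
  | c => lociReadingG S (overrideV5 pending) c

/-- The loci still consulting `pending` after Δ5. DATA (a list). [folklore] -/
def unresolvedV5 : List Locus := [.SHE, .absAnab_prop1_2_1_vii, .etTh]

/-- `unresolvedV5`: three entries, all among `unresolvedV4`. [folklore] -/
theorem unresolvedV5_sub : unresolvedV5.length = 3 ∧ ∀ c ∈ unresolvedV5, c ∈ unresolvedV4 := by decide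

variable {T : ThetaIndex} (S : FullSituation T) (pending : Locus → Prop)

/-- knitted: Cor 2.3 is complete in H. [folklore] -/
theorem lociReadingH_cor2_3 : lociReadingH S pending .cor2_3 =
    (N_IUTchIII_Cor2_3_i.{0} ∧ N_IUTchIII_Cor2_3_ii.{0} ∧ N_IUTchIII_Cor2_3_iii.{0} ∧ N_IUTchIII_Cor2_3_iv.{0}) := rfl
/-- fall-through: (IPL) is still read through the situation (part l). [folklore] -/
theorem lociReadingH_IPL : lociReadingH S pending .IPL = S.link.IPL := rfl
/-- fall-through: a Δ4 locus keeps its node. [folklore] -/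
theorem lociReadingH_thm1_5_iii : lociReadingH S pending .thm1_5_iii = N_IUTchIII_Thm1_5_iii.{0} := rfl
/-- still pending: (SHE) — through the override, H consults `pending` itself. [folklore] -/
theorem lociReadingH_SHE : lociReadingH S pending .SHE = pending .SHE := rfl
/-- still partly pending: [EtTh] ↦ its seven landed nodes ∧ `pending`. [folklore] -/
theorem lociReadingH_etTh : lociReadingH S pending .etTh =
    ((N_EtTh_Prop1_4_i.{0} ∧ N_EtTh_Prop1_4_ii.{0} ∧ N_EtTh_Def2_10.{0, 0, 0} ∧ N_EtTh_Prop2_11_i.{0, 0, 0, 0, 0, 0} ∧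
      N_EtTh_Prop2_14_ii.{0, 0, 0} ∧ N_EtTh_Def1_9_ii.{0} ∧ N_EtTh_Def2_13_i.{0}) ∧ pending .etTh) := rfl

/-- The override grants G's eleven-locus hypothesis from `pending` at the three. [folklore] -/
theorem overrideV5_of_three (hrest : ∀ c ∈ unresolvedV5, pending c) : ∀ c ∈ unresolvedV4, overrideV5 pending c := by
  have hSHE : pending .SHE := hrest _ (by decide)
  have hAb : pending .absAnab_prop1_2_1_vii := hrest _ (by decide)
  have hEt : pending .etTh := hrest _ (by decide)
  intro c hc
  cases c <;> first | exact trivial | exact hSHE | exact hAb | exact hEt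

/-- **The composed reading of record holds at all 85 loci given Theorem 3.11 as typed, (IPL), and `pending` at THREE loci** ((SHE),
[AbsAnab] Prop 1.2.1 (vii), the remainder of [EtTh]): the completed loci by their landed witnesses BY NAME, the section-level citations
trivially, everything else by part m's `lociReadingG_of_eleven` through the override. [folklore] -/
theorem lociReadingH_of_three (hS : S.Statement) (hIPL : S.link.IPL) (hrest : ∀ c ∈ unresolvedV5, pending c) :
    ∀ c, lociReadingH S pending c := by
  have hG : ∀ c, lociReadingG S (overrideV5 pending) c :=
    lociReadingG_of_eleven S (overrideV5 pending) hS hIPL (overrideV5_of_three pending hrest)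
  intro c
  unfold lociReadingH
  split
  · exact ⟨N_IUTchIII_Cor2_3_i_part, N_IUTchIII_Cor2_3_ii_part, N_IUTchIII_Cor2_3_iii_part, N_IUTchIII_Cor2_3_iv_part⟩
  · exact ⟨N_IUTchIII_Rmk1_5_1_i_holds, N_IUTchIII_Rmk1_5_1_ii_holds⟩
  · exact ⟨N_IUTchIII_Rmk2_3_3_vi_holds, N_IUTchIII_Rmk2_3_3_vii_holds⟩
  · exact ⟨N_IUTchII_Rmk1_11_3_ii_holds, N_IUTchII_Rmk1_11_3_i_holds, N_IUTchII_Rmk1_11_3_iii_holds,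
      N_IUTchII_Rmk1_11_3_v_holds⟩
  · exact trivial
  · exact trivial
  · exact trivial
  · exact trivial
  · exact hG _

/-- **In the least reading of the printed proof (`Cor312Least`) over the typed tree, the disputed observation of Step (xi-f) —
"constitutes … a construction … of `−|log(q)|`" — is derivable, given Theorem 3.11 as typed and (IPL), EXACTLY when the three
unresolved loci are granted** ((SHE), [AbsAnab] Prop 1.2.1 (vii), the [EtTh] remainder — all three lie upstream of (xi-f), and every
other upstream locus is kernel-resolved). [folklore] -/
theorem derivable_xi_f_iff_three (hS : S.Statement) (hIPL : S.link.IPL) :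
    Derivable (lociReadingH S pending) .constitutesConstruction ↔
      (pending .SHE ∧ pending .absAnab_prop1_2_1_vii ∧ pending .etTh) := by
  rw [derivable_constitutesConstruction_iff]
  constructor
  · intro h
    exact ⟨h .SHE (by decide), h .absAnab_prop1_2_1_vii (by decide), (h .etTh (by decide)).2⟩
  · rintro ⟨h1, h2, h3⟩ c _
    refine lociReadingH_of_three S pending hS hIPL (fun c hc => ?_) c
    simp only [unresolvedV5, List.mem_cons, List.mem_nil_iff, or_false] at hc
    rcases hc with rfl | rfl | rfl
    exacts [h1, h2, h3]

/-! ## 3. Apex and census -/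

/-- **APEX, author's terms, loci transparent (three left).** Part m's `summit_of_cor312_M_eleven` over the reading of record H: `ABC` from
V, T, A, hInd; per curve a full situation with Theorem 3.11 AS TYPED (`hThm`) and (IPL) as read (`hIPL`); `pending` granted at the THREE
unresolved loci only (`hrest`: (SHE), [AbsAnab] Prop 1.2.1 (vii), [EtTh]); pilot nouns, admissibility, the two finiteness clauses; the
twenty inferences under H (`hC`); the (xi-f) sentence read as Reading 1 (`hread`); the number identifications. kernel_hyps = 11 (hInd,
hadm, hreal, hqreal, hThm, hIPL, hrest, hC, hread, hΘ, hq). [claim: Mochizuki2012, status: disputed] -/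
theorem summit_of_cor312_M_three (V : HeightFamily) (Tm : Thm110Family V) (A : AbcDictionary V)
    (hInd : MochizukiIndeterminacies Tm) {TI : V.Pt → ThetaIndex} (S : ∀ P, FullSituation (TI P))
    (Pn : ∀ P, PilotNouns (S P).toLatticeSituation) (n m : ℤ)
    (hadm : ∀ P (j : (TI P).LabelStar) (vQ : (TI P).VQ), (Pn P).ComponentAdm n m j vQ)
    (hreal : ∀ P, (Pn P).NegLogThetaReal n m) (hqreal : ∀ P, (Pn P).NegLogQReal n m)
    (hThm : ∀ P, (S P).Statement) (hIPL : ∀ P, (S P).link.IPL) (pending : Locus → Prop)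
    (hrest : ∀ c ∈ unresolvedV5, pending c) {O : Obs → Prop} (hC : ∀ P, Chain (lociReadingH (S P) pending) O)
    (hread : ∀ P (j : (TI P).LabelStar) (vQ : (TI P).VQ), O .constitutesConstruction →
      ((Pn P).toCor312Setting n m j vQ (hadm P j vQ)).RepresentedVol)
    (hΘ : ∀ P, (Pn P).negLogTheta n m = (Tm.X P).negLogTheta) (hq : ∀ P, (Pn P).negLogQ n m = -(Tm.X P).absLogq) :
    _root_.ABC :=
  abc_of_indeterminacies_of_cor312 V Tm A hInd fun P => by
    have hc : (Pn P).Cor312At n m :=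
      (Pn P).cor312At_of_componentwise n m (hadm P) (hreal P) (hqreal P)
        fun j vQ => setting_cor312_of_chain _ (lociReadingH_of_three (S P) pending (hThm P) (hIPL P) hrest) (hC P)
          (hread P j vQ)
    unfold Thm110Data.Cor312
    rw [← hΘ, ← hq]
    exact hc.2.2

/-- CENSUS after Δ5: of the 85 loci cited by the statement and proof of Cor. 3.12, 82 are resolved to landed nodes / situation fields /
data aliases / owner-noted / section-level citations; 3 remain ((SHE), [AbsAnab] Prop 1.2.1 (vii), [EtTh] partly); of (xi-f)'s 75 upstream
loci, the unresolved ones are now (SHE), [AbsAnab] Prop 1.2.1 (vii), [EtTh]. [folklore] -/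
theorem knitted_count_v5 : (74 : ℕ) + 8 = 82 ∧ 82 + 3 = 85 ∧
    (Step.xi_f.upstreamLoci.filter fun c => decide (c ∈ unresolvedV5)) = [.SHE, .absAnab_prop1_2_1_vii, .etTh] := by
  refine ⟨rfl, rfl, ?_⟩
  decide

/-- The STEPS whose cited loci still consult `pending` after Δ5: (ii) and (vi) (the [EtTh] citation; (vi) also [AbsAnab] Prop 1.2.1
(vii)), (xi-b)–(xi-e) ((SHE)), and (xi-h) ([EtTh], for the `N`-th-power non-variant) — every other node of the printed proof cites only
kernel-resolved loci. [folklore] -/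
theorem steps_consulting_pending :
    (Step.all.filter fun s => decide (∃ c ∈ s.cites, c ∈ unresolvedV5)) = [.ii, .vi, .xi_b, .xi_c, .xi_d, .xi_e, .xi_h] := by
  decide

end Summit.ABC.IUTFork.DAG

end
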